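import Mathlib
import HarnessLib
import HarnessLib.Audit
import Summits.CriticalPhenomena.Statement
import Literature.Probability.Percolation.CardyFormula
import Literature.Barriers.CriticalPhenomena.EmbeddingModulusUniqueness
import Summits.CriticalPhenomena.CardyFormulaZ2.Theorems.CardyIKTransportCrudeToCanonical
import HarnessLib.Audit.Status.Attr

/-!
Route: CardySelfDualSegment

DORMANT since 2026-08-26T10:53:29Z (reconciler: no traction for 8.3 d (last activity item-evidence-added at 2026-08-18T02:29:32Z); parked, not closed — `ledger route dormant route-CriticalPhenomena-CardySelfDualSegment --off` to reactiv) — unstaffed, not closed; items shared with open routes are served there. `ledger route dormant <id> --off` reactivates.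

# Route CardySelfDualSegment — Smirnov to Z2 along a self-dual FKG segment: linear universality by
continuity, modulus pinned by the quarter-turn

It suffices to show X = LINEAR UNIVERSALITY ALONG THE SELF-DUAL CORNER SEGMENT (card
self-dual-cell-segment, made
concrete): let M_t, t ∈ [0,1], be bond percolation on ℤ² in which, independently at every vertex v,
the EAST edge of v
is open iff a fair coin c_v = 1 and the NORTH edge of v is open iff c_v ≠ d_v, d_v an independent
Bernoulli(t/2)
"splitting bit" (law `prodBernoulli`, pushed to bond configurations). M_1 is P_(1/2) bond
percolation on ℤ² exactly;
M_0 opens the two edges of each north-east corner together, which is site percolation on the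
triangular lattice of
corners (the card's cell law (½|0,0,0|½)); every M_t is self-dual (its planar dual is M_t rotated by
π), FKG (corner
law (½−t/4 | t/4, t/4 | ½−t/4) satisfies the lattice condition iff t ≤ 1) and symmetric under the
diagonal
reflection. X says: for every t there is a modulus α_t in the upper half-plane such that the crude
crossing
probabilities of M_t (drawn on √2ℤ², event `embDomainCrossing`) of every conformal rectangle R'
converge to Cardy's
F(η(φ_α R')), φ_α = `moduliShear α` Beffara's shear x+iy ↦ x+αy. At t = 0 this is Smirnov's theorem
with
α_0 = e^(iπ/3) (PROVED in tree: `hasCrossingLimit_triDomainCrossingProb_holds`); at t = 1 the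
order-4 rotation of ℤ²
and Beffara's modulus rigidity (PROVED: `BeffaraShearDistortsModulus_holds`) force α_1 = i, i.e.
Cardy on ℤ².
X is reached by a continuity method on G = {t : ∃ α ∈ ℍ, CardyMod t α}: G open (crux SegmentOpen), G
closed (crux
SegmentClosed), both fed by the quantitative crux UniformMarginality, 0 ∈ G (crux SmirnovBasePoint).
Lean: `let prm : unitInterval → Literature.Probability.LatticeModels.Site 2 × Fin 2 → unitInterval
:= fun t i => if i.2 = 0 then Literature.Probability.Percolation.half else
Literature.Probability.Percolation.half * t; let cfg : Set
(Literature.Probability.LatticeModels.Site 2 × Fin 2) →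
Literature.Probability.Percolation.BondConfig (Literature.Probability.LatticeModels.Site 2) := fun S
=> {e | ∃ v : Literature.Probability.LatticeModels.Site 2, (e = s(v, v + ![1, 0]) ∧ (v, (0 : Fin 2))
∈ S) ∨ (e = s(v, v + ![0, 1]) ∧ ((v, (0 : Fin 2)) ∈ S ↔ (v, (1 : Fin 2)) ∉ S))}; let P :
unitInterval → Literature.Probability.RandomPlanarGeometry.ConformalRectangle → ℝ → ℝ := fun t R δ
=> (Literature.Probability.LatticeModels.prodBernoulli (prm t)).real {S | cfg S ∈
Literature.Probability.Percolation.embDomainCrossing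
Literature.Probability.LatticeModels.squareLatticeEmbedding.z R.carrier δ (R.arc 0) (R.arc 2)}; let
CardyMod : unitInterval → ℂ → Prop := fun t α => ∀ (R R' :
Literature.Probability.RandomPlanarGeometry.ConformalRectangle) (φ :
Literature.Probability.RandomPlanarGeometry.ConformalEquiv UpperHalfPlane.upperHalfPlaneSet
R.carrier) (x : Fin 4 → ℝ), R.carrier = Literature.Barriers.CriticalPhenomena.moduliShear α ''
R'.carrier → (∀ i, R.pt i = Literature.Barriers.CriticalPhenomena.moduliShear α (R'.pt i)) →
R.IsUniformizing φ x → Filter.Tendsto (P t R') (nhdsWithin 0 (Set.Ioi 0)) (nhds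
(Literature.Probability.RandomPlanarGeometry.cardyFunction
(Literature.Probability.RandomPlanarGeometry.crossRatio x))); ∀ t : unitInterval, ∃ α : ℂ, 0 < α.im
∧ CardyMod t α`

## Assembly
Pure logic plus the topology of [0,1] (sorry-free: the route's `closes`; planner Sketch.lean):
UniformMarginality
makes SegmentOpen and (with UniformBoxCrossing) SegmentClosed unconditional, so G is clopen in the
connected space
`unitInterval`; SmirnovBasePoint gives 0 ∈ G (Im e^(iπ/3) = sin(π/3) > 0), hence G = [0,1] and 1 ∈
G;
QuarterTurnPinning turns 1 ∈ G into crude Cardy on ℤ² in every conformal rectangle, and the GLOBAL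
discretisation bridge
CrudeToCanonical (stmt-4968, shared with CardyIKTransport; replaces the per-R stmt-0787 since rev
13) into `CardyFormulaZ2`.
This is literally the deciding theorem `closes` (crux-only: all seven hypotheses are cruxes of this
route). The Target is the
statement G = [0,1] read pointwise.

Rationale: WHY THIS LINE. Beffara's barrier (Beffara2008Universal Prop. 4; tree `EmbeddingModulusUniqueness`)
says embedding-blind tools can at
best deliver universality "modulo an unidentified linear map" (LanglandsPouliotSaintaubin1994 §2.4;
proved inside
isoradial families by DKKMO2020Rotational Thm 1.9); this route asks for exactly that and nothing
more, PERTURBATIVELY,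
along an explicit compact path of honest critical models joining Smirnov's solved point to bond-ℤ²
inside one lattice:
the corner family M_t is critical for every t by Bollobás–Riordan's self-duality theorem
(BollobasRiordan2010 Thm 2.1
/ Cor. 2.3, hyperlattice form of the Ziff–Scullard–Chayes–Lei cell criterion, ChayesLei2006), FKG up
to and including
the endpoint, and its t-derivative is a Russo sum ⅛Σ_v[P(A⁺_v) − P(A⁻_v)] of two 4-arm sub-patterns
whose leading
δ^(-3/4) orders cancel identically (the local constants λ⁺ = λ⁻ are forced equal by the exact
identity P_t(square) ≡ ½,
all t, δ) — the deformation is marginal, as a moduli deformation must be, and the modulus is never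
computed: it is
tracked as an unknown α_t and pinned at the end by the right angle of ℤ² (Beffara2008Universal
§2.2). Imported
areas: continuity/deformation method (PDE, moduli), noise-sensitivity and pivotal-measure technology
of critical
percolation (GarbanPeteSchramm2013, doi:10.1007/BF02698830) for the marginality crux, plane
quasiconformal geometry
for closedness. Unlike route CardyIsoradial (star–triangle transport inside Grimmett–Manolescu's
bond class, which
excludes site-𝕋) the path here starts AT Smirnov's theorem; unlike
CardyRotToConf/CardyViaSLE6/CardyUniqueLimit no
symmetry upgrade of ℤ² limits is attempted — symmetry enters only in the elementary pinning step;
unlike Beffara's own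
interpolation on the centred square lattice (barrier `CoveringLatticeShift`) the modulus is allowed
to MOVE, so only
boundedness, not vanishing, of the Russo sum is needed. Negatives index: no CardyFormulaZ2 statement
is refuted
(only stmt-0772, SAW side); nothing here restates it.

RANKED CRUXES. Since the crux-only deciding-theorem rule (2026-08-16) `closes` may assume CRUX items
only, so every UNPROVED LEAF of the sweep is a crux of this route — seven, the cap: four research
cruxes (SegmentOpen, UniformMarginality, SegmentClosed, UniformBoxCrossing) and three
provable-in-kind dictionary/endpoint steps ranked last (SmirnovBasePoint, QuarterTurnPinning,
CrudeToCanonical); this is one thesis, not two — the last three carry no research risk and are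
cruxes only because nothing in the tree proves them yet. `closes : SegmentOpen → UniformMarginality
→ SegmentClosed → UniformBoxCrossing → SmirnovBasePoint → QuarterTurnPinning → CrudeToCanonical →
CardyFormulaZ2` (sweep proved inline; Target = X is DERIVED, by the support ContinuitySweep, and is
not a hypothesis).
#0 Target (target) — LinearUniversalityOnSegment: for every t ∈ [0,1] there is α with Im α > 0 such
that CardyMod t α holds — for all conformal rectangles R, R' with R = φ_α(R') (carrier and marked
points) and every uniformizing datum (φ, x) of R, the crude M_t-crossing probability of R' at mesh δ
tends to cardyFunction(crossRatio x) as δ → 0⁺. (why it might fail: it contains conformal invariance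
of bond-ℤ² crossings (t = 1, up to a linear map) and universality for a one-parameter family; a
single M_t with a non-Cardy or non-existent crossing limit refutes it.)
[LanglandsPouliotSaintaubin1994, Beffara2008Universal, Smirnov2001, BollobasRiordan2010]
#2 SegmentOpen (crux) — OPENNESS = perturbative linear universality (card C1): assuming
UniformMarginality, the set G = {t ∈ [0,1] : ∃ α, Im α > 0 ∧ CardyMod t α} is open in [0,1]; i.e. if
M_(t₀) has Cardy limits after the shear φ_(α₀), then every M_t with |t − t₀| small has Cardy limits
after some shear φ_(α_t). [deps: UniformMarginality] [difficulty: open-problem] (why it might fail: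
no perturbative universality technology exists: noise sensitivity (BKS 1999) kills pathwise
couplings between M_t and M_(t₀), so identification of subsequential limits of M_t as a LINEAR image
of CLE₆/Cardy needs a law-level rigidity theorem nobody has; marginality alone does not identify the
limit.) [doi:10.1007/BF02698830, GarbanPeteSchramm2013, SchrammSmirnov2011, Beffara2008Universal,
CamiaNewman2006]
#3 UniformMarginality (crux) — QUANTITATIVE MARGINALITY of the self-dual deformation: for every t₀ ∈
[0,1], every conformal rectangle R and ε > 0 there is η > 0 such that |P_t(R, δ) − P_(t₀)(R, δ)| < ε
for all t with |t − t₀| < η and ALL meshes δ > 0 (equicontinuity in the model parameter, uniform in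
the mesh). Russo: ∂_t P_t = ⅛ Σ_v [P_t(A⁺_v) − P_t(A⁻_v)], A^± the two 4-arm sub-patterns at the
corner v; the δ^(-2)·δ^(5/4) leading orders must cancel to relative precision δ^(3/4). [difficulty:
XL] (why it might fail: after the forced cancellation λ⁺ = λ⁻ the Russo sum is
δ^(-3/4)·Σ(convergence rate of local 4-arm statistics); bounded iff that rate is ≥ (δ/d)^(3/4); the
5-arm gap is exactly 3/4 (log-divergence possible) and no IIC rate that strong is known even on 𝕋
(Beffara §5.2).) [Beffara2008Universal, GarbanPeteSchramm2013, doi:10.1007/BF02698830, Nolin2008,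
SchrammSmirnov2011]
#4 SegmentClosed (crux) — CLOSEDNESS (card C2): assuming the uniform box-crossing property along the
segment and UniformMarginality, G is closed in [0,1]: if t_n → t with moduli α_n then (α_n) is
precompact in the open upper half-plane (uniform RSW forbids degenerate parallelogram moduli), the
crossing limits of M_t exist (marginality), and they equal F(η(φ_α R')) for a limit modulus α
(continuity of conformal moduli under near-identity linear maps). [deps: UniformMarginality,
UniformBoxCrossing] [difficulty: L] (why it might fail: soft only modulo plane conformal geometry
absent from Mathlib — ConformalRectangle structure on φ_α-images, properness (moduli of φ_α-images
of a fixed rectangle degenerate as α → ∂ℍ ∪ ∞) and continuity in α of η(φ_α R'); a gap in either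
leaves a limit modulus on the real axis.) [LehtoVirtanen1973, Ahlfors1973CI, Beffara2008Universal,
BollobasRiordan2010]
#5 UniformBoxCrossing (crux; ledger rank may still read 9) — UNIFORM A-PRIORI THEORY (card C2): the
box-crossing (RSW) property holds for the laws of M_t drawn on ℤ², with constants c(ρ), n₀(ρ)
uniform in t ∈ [0,1]: `BoxCrossingBounds` for every aspect ratio. Inputs: P_t(square crossing) = ½
up to boundary terms for all t, δ (self-duality = π-rotation + diagonal reflection), FKG (lattice
condition iff t ≤ 1), translation invariance and ONE reflection axis; NOT in print as such — KST
2023 need the full symmetry group of ℤ², BR 2010 §6 give only the large-rectangles property; route: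
Kesten's one-axis RSW (Kesten 1982 Ch. 6) after realising M_t as periodic inhomogeneous site
percolation on a planar gadget graph, or KST §6 symmetric stochastic domination. THE ONE ITEM THAT
MAY BE FALSE (hard-way crossings of 2:1 boxes → 0 along a subsequence for some 0 < t < 1): staffed
right after the research cruxes. [difficulty: L] [BollobasRiordan2010, KohlerSchindlerTassion2023,
Kesten1982, GrimmettManolescuAOP2013, Russo1978]
#6 SmirnovBasePoint (crux, provable-in-kind; law dictionary PROVED in tree:
`cornerPercolation_zero`) — BASE POINT 0 ∈ G with α_0 = e^(iπ/3) (card C4 dictionary, 𝕋 side):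
CardyMod 0 triZeta — the square-frame M_0 (corner edges opened together = site percolation on the
φ_ζ⁻¹-image of 𝕋: open sites u ~ u±e₁, u±e₂, u±(e₁−e₂)) crossing of R' converges to F(η(φ_ζ R'));
this is Smirnov's theorem `hasCrossingLimit_triDomainCrossingProb_holds` (proved in tree) pushed
through `triEmbed = φ_ζ ∘ toComplex`, plus boundary bookkeeping between the crude event
`embDomainCrossing` (2δ slack, sheared by φ_ζ; M_0-clusters carry closed leaf vertices) and G02's
`triCrossing` (largest component, discrete arcs) — a crude↔G02 sandwich on 𝕋 (TriApproxDomain,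
TriCollarSandwich in tree). It is also where a misstatement of the whole family would surface first.
[difficulty: M] [Smirnov2001, BollobasRiordan2006, CamiaNewman2006, ChayesLei2006]
#7 QuarterTurnPinning (crux, provable-in-kind; law identity M_1 = P_½ bond-ℤ² PROVED in tree:
`cornerPercolation_one`) — ENDPOINT PINNING (card C3): if CardyMod 1 α holds for some α with Im α >
0 then bond percolation on ℤ² at ½ satisfies Cardy's formula in the crude discretisation
(`embDomainCrossing squareLatticeEmbedding.z`) in EVERY conformal rectangle. Proof: at t = 1 the
corner law is the i.i.d. fair law, so P_1 = the P_(1/2) crude crossing probability exactly; the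
quarter-turn r of ℤ² preserves measure and transports the marked event, so CardyMod 1 α gives η(φ_α
R') = η(φ_α r R') for all R', i.e. E = φ_α r φ_α⁻¹ preserves all conformal moduli; by Beffara's
rigidity (tree: `BeffaraShearDistortsModulus_holds`, pattern of `similarityRigidity_proof`) E is a
similarity, and E² = −1 forces E = ±i·, whence α = φ_α(i) = ±i·φ_α(1), α = i; then take R = R'.
[difficulty: M] [Beffara2008Universal, LanglandsPouliotSaintaubin1994, DKKMO2020Rotational]
#8 CrudeToCanonical (crux, provable-in-kind; shared verbatim with route CardyIKTransport,
stmt-CriticalPhenomena-4968) — GLOBAL DISCRETISATION BRIDGE on ℤ²: Cardy for the crude embedded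
crossing event of bond-ℤ² at ½ in EVERY conformal rectangle implies Cardy for G02's
`bondDomainCrossingProb` in every conformal rectangle (= CardyFormulaZ2). It REPLACES the per-R
bridge stmt-0787 used until rev 12: `closes` feeds it the ∀R conclusion of QuarterTurnPinning, so
the global form — weaker, and the form the approximating-domain sandwich actually proves
(CamiaNewman2006 Thm 3 / BollobasRiordan2006 Ch. 7; bulk property of Ω_δ now a tree theorem for
every Jordan domain) — suffices; 0787 → 4968 is one line, so a proof of 0787 still closes it.
[difficulty: M] [BollobasRiordan2006, CamiaNewman2006, arXiv:1204.0505]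

TWO-LAYER PLAN. Foreseen glued splits (none filed now): UniformMarginality ⇐
FirstOrderAtSmirnovPoint (sup_δ |∂_t P_t|_(t=0)| < ∞,
a statement about site-𝕋 4-arm sub-patterns only — the content of card
modulus-response-at-smirnov-point) →
LocalDualityCancellation (λ⁺ = λ⁻ with rate (δ/d)^(3/4+) uniformly in t, from uniform RSW + a
quantitative IIC
coupling) → UniformMarginality. SegmentClosed ⇐ ModuliCompactness (Box ⇒ α_t stays in a compact of
ℍ) →
ModulusContinuity (α ↦ η(φ_α R') continuous, proper) → SegmentClosed. SegmentOpen ⇐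
SubsequentialLimitsAreCLE-type
(tightness + Schramm–Smirnov for M_t, uniform in t) → LinearRigidity (a CLE-type ensemble whose
arm/pivotal measures
are a linear image of those of a Cardy model is the linear image of that model) → SegmentOpen.

KILL CRITERIA. ¬UniformMarginality (a conformal rectangle R and meshes δ_k → 0 with |P_t −
P_(t')|(R, δ_k) bounded below for
t' → t, e.g. a proved δ^(-3/4)- or log-divergence of the Russo sum at t = 0) closes the route
outright
(`close --reason refuted:UniformMarginality`): the continuity method is dead and the card's
"marginal deformation"
picture is false; the refutation would itself be a notable fact about perturbations of Smirnov's
model. ¬SegmentOpen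
with marginality true means universality fails perturbatively near some critical M_t — closes the
route and refutes
LPS linear universality for FKG self-dual models (major either way). ¬SmirnovBasePoint or
¬QuarterTurnPinning can only
come from a discretisation mis-specification (crude event vs G02) — report to operator, restate, do
not close.
CardyFormulaZ2 proved by any other route moots this one; a proof of CardyUniversality-type transport
covering
site-𝕋 (CardyIsoradial r2 extended) would supersede it.

NOT DECOMPOSED YET. The interior of SegmentOpen (which law-level rigidity statement; loop-ensemble
vs quad-crossing (Schramm–Smirnov)
formulation of "limit of M_t"); the rate exponent in UniformMarginality and whether Lipschitz
(bounded Russo sum) or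
only Hölder/continuity in t is true; the two conformal-geometry lemmas inside SegmentClosed; the
gadget/site
realisation used for UniformBoxCrossing; continuity of t ↦ α_t (not needed by the assembly: clopen
argument uses
∃α only); torus/Pinson checks of the moving modulus (numerics, card bullet 4).

CHEAPEST FALSIFIER. Numerics on the Russo sum at Smirnov's point: for the 2:1 rectangle (or any
non-square quad) in the square frame,
estimate D(L) = ⅛ Σ_v [P_0(A⁺_v) − P_0(A⁻_v)] for site-𝕋-equivalent M_0 at L = δ⁻¹ = 16, 32, 64,
128, 256 by Monte
Carlo with the explicit local patterns (A⁻: open arms land on v+e₀ and v+e₁ with v cut off; A⁺: one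
arm at v, the
other on the externally joined pair) — bounded D(L) supports UniformMarginality, growth like L^(3/4)
kills the route,
log L growth flags the borderline 5-arm scenario. Exact alternative: transfer-matrix evaluation of
∂_t P_t(δ) for
strips of width ≤ 14. Not run here (plancard unit, compute is off-box); it is the first refuter job.
Lookup already
done: KST 2023 p.3/p.5 (symmetry group of ℤ² required) and BR 2010 §6 (large-rectangles property
only) confirm
UniformBoxCrossing is not in print but expected.

NUMBERS. Corner law of M_t: P(11) = P(00) = ½ − t/4, P(10) = P(01) = t/4 (fair marginals,
disagreement probability t/2); FKG
lattice condition (½ − t/4)² ≥ (t/4)² ⇔ t ≤ 1; card's parameter t_card = t/4 ∈ [0, ¼]. Moduli: α_0 =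
e^(iπ/3)
(Im = √3/2 ≈ 0.866), α_1 = i expected; P_t(n×n square crossing) = ½ + o(1) for all t. Exponents
(site-𝕋, expected
universal): 4-arm 5/4, hence naive Russo sum δ^(-3/4); polychromatic 5-arm 2 (gap 3/4, borderline),
6-arm 35/12;
ν = 4/3. Items at open: 9 (3 cruxes, 4 supports, target, assembly); after the crux-only repair (rev
13): 7 cruxes, support ContinuitySweep (glue → Target, provable now), target, assembly.

DEFINITION REQUESTS. D1 HAS LANDED (2026-08-15):
`Literature/Probability/Percolation/CornerPercolation.lean` —
cornerParam/cornerConfig/cornerPercolation/cornerCrossingProb with `prm = cornerParam`, `cfg =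
cornerConfig`, `P = cornerCrossingProb` syntactically, `cornerPercolation_one` (M_1 = bond-ℤ² at ½),
`cornerPercolation_zero` (M_0 = triSite ½ pushed by upTriangleConfig), self-duality
`cornerPercolation_map_dualConfig`, transpose/shift invariance, exact identities incl.
M_t(LR([0,n+1]×[0,n])) = ½ — all proved; provers should restate the inlined `let` blocks over it.
Original request: D1 (to file after open, `--kind definition --topic
Literature/Probability/Percolation`): `cornerPercolation (t :
unitInterval) : Measure (BondConfig (Site 2))` = the law of M_t (pushforward of `prodBernoulli`
under the corner map)
with its basic API (probability measure, t = 1 is `bondPercolation (zdGraph 2) half`, t = 0 ↔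
`triSitePercolation
half` cluster dictionary, self-duality under `dualConfig` + π-rotation, FKG, diagonal-reflection
invariance), so that
the seven inlined `let` blocks of this route can be restated over it. Cite/fact wanted:
BollobasRiordan2010 Cor. 2.3
(criticality of self-dual 3-uniform hyperlattice models with arbitrary pair weights) as a named fact
over D1.

Novelty: Searches (2026-08-15, this unit; local lit daemon and arXiv/OpenAlex APIs rate-limited, so remote
zbMATH/Crossref +
held texts): `lit search --source zbmath "hyperlattice percolation self-dual critical"` (1 hit:
arXiv:1001.4674, read
pp. 7–10, 15, 20, 31: Thm 2.1/2.2, Cor 2.3, §6 large-rectangles property only); `lit search --source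
crossref
"universality of crossing probabilities … Langlands Pichet Pouliot Saint-Aubin"`
(doi:10.1007/bf01049720 LPPS 1992,
doi:10.1090/s0273-0979-1994-00456-2 LPS 1994: numerical linear universality of anisotropic models —
the conjecture
this route proves perturbatively); `lit search --source crossref "Köhler-Schindler Tassion crossing
probabilities"`
+ `lit read arxiv:2011.04618 --grep symmetr` (p.3 L5, p.5 L6: full ℤ² symmetry group assumed; §6
symmetric
stochastic domination); `lit galaxy search "self-dual hyperlattice percolation" --star all` (0
hits); tree reads:
Barriers EmbeddingModulusUniqueness(+Proofs: Beffara Prop. 4 fully proved), CoveringLatticeShift,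
CardyFormula,
CardyFormulaConformalInvariance (Smirnov proved); the card's own audited searches (Chayes–Lei
math-ph/0601023,
0710.3446, BCL 1004.4673/4676, GM 1105.5535, BR 1001.4674; 24 sibling cards) and `ledger idea list`
(125 cards:
smirnov-to-square-shear-flow / moving-modulus-shear-ode = Russo-ODE engine on a covering-lattice
family, graded
variant/duplicate; modulus-response-at-smirnov-point = first-order response only).
Nearest prior art found: ChayesLei2007 + BinderChayesLei20  [refs: 10.1007/bf01049720, 10.1090/s0273-0979-1994-00456-2, 1001.4674, 2011.04618, doi:10.1007/bf01049720, doi:10.1090/s0273-0979-1994-00456-2, arxiv:2011.04618, ChayesLei2007, BinderChayesLei2010, BollobasRiordan2010, LanglandsPouliotSaintaubin1994]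

Barriers (technique_class: self-dual-interpolation continuity-method symmetry-pinning): - technique_class: self-dual-interpolation continuity-method symmetry-pinning linear-universality
- Literature.Barriers.CriticalPhenomena.EmbeddingModulusUniqueness: the route is BUILT on its "NOT
blocked" clause — Target, SegmentOpen, SegmentClosed, UniformMarginality are all "modulo an
unidentified linear map φ_α" statements, invariant under shearing the lattice, exactly what blind
arguments may deliver (cf. DKKMO Thm 1.9); the modulus is identified only in QuarterTurnPinning
through the exact order-4 rotation of ℤ² (evasion (i)) and the barrier's own proved rigidity
`BeffaraShearDistortsModulus_holds`.
- Literature.Barriers.CriticalPhenomena.SmirnovTriangularOnly: Smirnov's argument is used only at t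
= 0, where it is a theorem in the tree; no colour switching is transplanted to t > 0 (the route
concedes that discrete holomorphicity fails there — the limit is sheared — and replaces it by
continuity in t).
- Literature.Barriers.CriticalPhenomena.CoveringLatticeShift: Beffara's interpolation needs the
Russo sum to VANISH (constant modulus i along P_(1/2,q), shift swaps q ↔ 1−q); here the family is
different (corner-correlated bonds on ℤ² itself, self-dual for every t with no q ↔ 1−q defect) and
the modulus moves, so only BOUNDEDNESS of the Russo sum is required (UniformMarginality), with the
leading order cancelled by the local identity λ⁺ = λ⁻ rather than by a shift pairing; conceded: the
residual is the same "speed of convergence to the IIC" quantity Beffara could not contr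

History (route lifecycle, newest last):
- 2026-08-16T03:12:03Z · rev 6: dropped TargetGlue — route-choice (a), step 1/3: withdraw stmt-CriticalPhenomena-14199 (TargetGlue, rank 9) to re-file the SAME glue statement at rank 10 — the renderer orders suppo (planner-rchoice-CriticalPhenomena-CardySelfDua-822d9597-0)
- 2026-08-16T03:22:32Z · rev 8: dropped stmt-CriticalPhenomena-14199 — route-choice (a) target-unreachable: glue item ContinuitySweep (stmt-CriticalPhenomena-14382, support rank 10) = SmirnovBasePoint → SegmentOpen → SegmentClosed (planner-rchoice-CriticalPhenomena-CardySelfDua-822d9597-0)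
- 2026-08-16T03:51:01Z · AUTO-CRUX (backfill): Target — hypotheses of the deciding theorem that nothing in the route derives are cruxes (operator:999:586464)
- 2026-08-16T04:54:31Z · rev 14: restated Assembly (stmt-CriticalPhenomena-5477) — route-repair rbadge-g4, step 3a/3: restate Assembly (stmt-5477) onto the crux-only chain ending … → QuarterTurnPinning → CrudeToCanonical → CardyFormulaZ2 (= th (planner-rbadge-CriticalPhenomena-CardySelfDual-5e27c92a-g4-0)
- 2026-08-16T05:00:18Z · rev 15: dropped DiscretisationBridge — route-repair rbadge-g4, step 3b/3: drop the per-R DiscretisationBridge (stmt-CriticalPhenomena-0787) from THIS route — not load-bearing any more: since rev 13 t (planner-rbadge-CriticalPhenomena-CardySelfDual-5e27c92a-g4-0)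
- 2026-08-26T10:53:29Z · DORMANT — reconciler: no traction for 8.3 d (last activity item-evidence-added at 2026-08-18T02:29:32Z); parked, not closed — `ledger route dormant route-CriticalPhenomen (operator:999:2520002)

sub-problem: CardyFormulaZ2 · status: dormant · opened planner-plancard-CriticalPhenomena-CardyFormu-c44d3954-0 2026-08-15T11:41:16Z · rev 16 · ledger route-CriticalPhenomena-CardySelfDualSegment
GENERATED by the gate from the ledger (D-0016/17). Provers cite these decls: `theorem foo : Summit.CriticalPhenomena.CardyFormulaZ2.Theses.CardySelfDualSegment.<Decl> := …` in Summits/CriticalPhenomena/CardyFormulaZ2/Theorems/<Name>.lean.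
-/

namespace Summit.CriticalPhenomena.CardyFormulaZ2.Theses.CardySelfDualSegment

open scoped BigOperators Topology Manifold Classical MeasureTheory ProbabilityTheory Matrix InnerProductSpace ComplexConjugate ContinuousMap
open Filter Set Function TopologicalSpace MeasureTheory

attribute [summit_statement] _root_.CardyFormulaZ2

/-- item stmt-CriticalPhenomena-5470 · target (kind.auto-crux: conjecture-grade) · rank 0 · open · by planner
why it might fail: it asserts conformal invariance of bond-Z2 crossings at t = 1 (up to a linear map, pinned to alpha = i only afterwards) and linear universality along a whole one-parameter family; a single M_t with a non-Cardy or non-existent crossing limit refutes it.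
sources: LanglandsPouliotSaintaubin1994, Beffara2008Universal, Smirnov2001, BollobasRiordan2010
[target] LinearUniversalityOnSegment: for every t ∈ [0,1] there is α with Im α > 0 such that
CardyMod t α holds — for all conformal rectangles R, R' with R = φ_α(R') (carrier and marked points)
and every uniformizing datum (φ, x) of R, the crude M_t-crossing probability of R' at mesh δ tends
to cardyFunction(crossRatio x) as δ → 0⁺. -/
@[route_item "route-CriticalPhenomena-CardySelfDualSegment", crux]
def Target : Prop :=
  let prm : unitInterval → Literature.Probability.LatticeModels.Site 2 × Fin 2 → unitInterval := fun t i => if i.2 = 0 then Literature.Probability.Percolation.half else Literature.Probability.Percolation.half * t; let cfg : Set (Literature.Probability.LatticeModels.Site 2 × Fin 2) → Literature.Probability.Percolation.BondConfig (Literature.Probability.LatticeModels.Site 2) := fun S => {e | ∃ v : Literature.Probability.LatticeModels.Site 2, (e = s(v, v + ![1, 0]) ∧ (v, (0 : Fin 2)) ∈ S) ∨ (e = s(v, v + ![0, 1]) ∧ ((v, (0 : Fin 2)) ∈ S ↔ (v, (1 : Fin 2)) ∉ S))}; let P : unitInterval → Literature.Probability.RandomPlanarGeometry.ConformalRectangle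 → ℝ → ℝ := fun t R δ => (Literature.Probability.LatticeModels.prodBernoulli (prm t)).real {S | cfg S ∈ Literature.Probability.Percolation.embDomainCrossing Literature.Probability.LatticeModels.squareLatticeEmbedding.z R.carrier δ (R.arc 0) (R.arc 2)}; let CardyMod : unitInterval → ℂ → Prop := fun t α => ∀ (R R' : Literature.Probability.RandomPlanarGeometry.ConformalRectangle) (φ : Literature.Probability.RandomPlanarGeometry.ConformalEquiv UpperHalfPlane.upperHalfPlaneSet R.carrier) (x : Fin 4 → ℝ), R.carrier = Literature.Barriers.CriticalPhenomena.moduliShear α '' R'.carrier → (∀ i, R.pt i = Literature.Barriers.CriticalPhenomena.moduliShear α (R'.pt i)) → R.IsUniformizing φ x → Filter.Tendsto (P t R') (nhdsWithin 0 (Set.Ioi 0)) (nhds (Literature.Probability.RandomPlanarGeometry.cardyFunction (Literature.Probability.RandomPlanarGeometry.crossRatio x))); ∀ t : unitInterval, ∃ α : ℂ, 0 < α.im ∧ CardyMod t α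

/-- item stmt-CriticalPhenomena-5471 · crux · rank 2 · open · by planner
why it might fail: no perturbative universality technology: noise sensitivity (BKS 1999) kills pathwise couplings of M_t to M_t0, so identifying subsequential limits of M_t as a LINEAR image of the Cardy/CLE6 limit needs a law-level rigidity theorem nobody has; marginality alone cannot identify the limit (G = {0}?).
sources: BenjaminiKalaiSchramm1999, GarbanPeteSchramm2013, SchrammSmirnov2011, Beffara2008Universal, CamiaNewman2006
[crux] OPENNESS = perturbative linear universality (card C1): assuming UniformMarginality, the set G
= {t ∈ [0,1] : ∃ α, Im α > 0 ∧ CardyMod t α} is open in [0,1]; i.e. if M_(t₀) has Cardy limits after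
the shear φ_(α₀), then every M_t with |t − t₀| small has Cardy limits after some shear φ_(α_t).
[deps: UniformMarginality] [difficulty: open-problem] -/
@[route_item "route-CriticalPhenomena-CardySelfDualSegment", crux]
def SegmentOpen : Prop :=
  let prm : unitInterval → Literature.Probability.LatticeModels.Site 2 × Fin 2 → unitInterval := fun t i => if i.2 = 0 then Literature.Probability.Percolation.half else Literature.Probability.Percolation.half * t; let cfg : Set (Literature.Probability.LatticeModels.Site 2 × Fin 2) → Literature.Probability.Percolation.BondConfig (Literature.Probability.LatticeModels.Site 2) := fun S => {e | ∃ v : Literature.Probability.LatticeModels.Site 2, (e = s(v, v + ![1, 0]) ∧ (v, (0 : Fin 2)) ∈ S) ∨ (e = s(v, v + ![0, 1]) ∧ ((v, (0 : Fin 2)) ∈ S ↔ (v, (1 : Fin 2)) ∉ S))}; let P : unitInterval → Literature.Probability.RandomPlanarGeometry.ConformalRectangle → ℝ → ℝ := fun t R δ => (Literature.Probability.LatticeModels.prodBernoulli (prm t)).real {S | cfg S ∈ Literature.Probability.Percolation.embDomainCrossing Literature.Probability.LatticeModels.squareLatticeEmbedding.z R.carrier δ (R.arc 0) (R.arc 2)};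 let CardyMod : unitInterval → ℂ → Prop := fun t α => ∀ (R R' : Literature.Probability.RandomPlanarGeometry.ConformalRectangle) (φ : Literature.Probability.RandomPlanarGeometry.ConformalEquiv UpperHalfPlane.upperHalfPlaneSet R.carrier) (x : Fin 4 → ℝ), R.carrier = Literature.Barriers.CriticalPhenomena.moduliShear α '' R'.carrier → (∀ i, R.pt i = Literature.Barriers.CriticalPhenomena.moduliShear α (R'.pt i)) → R.IsUniformizing φ x → Filter.Tendsto (P t R') (nhdsWithin 0 (Set.Ioi 0)) (nhds (Literature.Probability.RandomPlanarGeometry.cardyFunction (Literature.Probability.RandomPlanarGeometry.crossRatio x))); let G : Set unitInterval := {t | ∃ α : ℂ, 0 < α.im ∧ CardyMod t α}; (∀ (t₀ : unitInterval) (R : Literature.Probability.RandomPlanarGeometry.ConformalRectangle) (ε : ℝ), 0 < ε → ∃ η > 0, ∀ t : unitInterval, dist t t₀ < η → ∀ δ : ℝ, 0 < δ → |P t R δ - P t₀ R δ| < ε) → IsOpen G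

/-- item stmt-CriticalPhenomena-5472 · crux · rank 3 · open · by planner
why it might fail: only handle is Russo: dP_t/dt = (1/8) Sum_v [P(A+_v) - P(A-_v)] ~ delta^(-2) delta^(5/4) = delta^(-3/4) unless the local constants cancel to relative precision delta^(3/4); the 5-arm gap is exactly 3/4 (log-divergence possible) and no IIC rate that strong is known even on T (Beffara sec. 5.2).
sources: Beffara2008Universal, GarbanPeteSchramm2013, BenjaminiKalaiSchramm1999, Nolin2008, SchrammSmirnov2011
[crux] QUANTITATIVE MARGINALITY of the self-dual deformation: for every t₀ ∈ [0,1], every conformal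
rectangle R and ε > 0 there is η > 0 such that |P_t(R, δ) − P_(t₀)(R, δ)| < ε for all t with |t −
t₀| < η and ALL meshes δ > 0 (equicontinuity in the model parameter, uniform in the mesh). Russo:
∂_t P_t = ⅛ Σ_v [P_t(A⁺_v) − P_t(A⁻_v)], A^± the two 4-arm sub-patterns at the corner v (either
single edge suffices / both edges needed); the δ^(-2)·δ^(5/4) leading orders must cancel to relative
precision δ^(3/4). [difficulty: XL] -/
@[route_item "route-CriticalPhenomena-CardySelfDualSegment", crux]
def UniformMarginality : Prop :=
  let prm : unitInterval → Literature.Probability.LatticeModels.Site 2 × Fin 2 → unitInterval := fun t i => if i.2 = 0 then Literature.Probability.Percolation.half else Literature.Probability.Percolation.half * t; let cfg : Set (Literature.Probability.LatticeModels.Site 2 × Fin 2) → Literature.Probability.Percolation.BondConfig (Literature.Probability.LatticeModels.Site 2) := fun S => {e | ∃ v : Literature.Probability.LatticeModels.Site 2, (e = s(v, v + ![1, 0]) ∧ (v, (0 : Fin 2)) ∈ S) ∨ (e = s(v, v + ![0, 1]) ∧ ((v, (0 : Fin 2)) ∈ S ↔ (v, (1 : Fin 2)) ∉ S))}; let P :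 unitInterval → Literature.Probability.RandomPlanarGeometry.ConformalRectangle → ℝ → ℝ := fun t R δ => (Literature.Probability.LatticeModels.prodBernoulli (prm t)).real {S | cfg S ∈ Literature.Probability.Percolation.embDomainCrossing Literature.Probability.LatticeModels.squareLatticeEmbedding.z R.carrier δ (R.arc 0) (R.arc 2)}; (∀ (t₀ : unitInterval) (R : Literature.Probability.RandomPlanarGeometry.ConformalRectangle) (ε : ℝ), 0 < ε → ∃ η > 0, ∀ t : unitInterval, dist t t₀ < η → ∀ δ : ℝ, 0 < δ → |P t R δ - P t₀ R δ| < ε)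

/-- item stmt-CriticalPhenomena-5473 · crux · rank 4 · closed · proved by Summit.CriticalPhenomena.CardyFormulaZ2.Theorems.segmentClosed_proof (prover) · by planner
why it might fail: Soft only modulo plane conformal geometry absent from Mathlib: ConformalRectangle structure on φ_α-images, PROPERNESS (uniform RSW ⇒ moduli α_n stay in a compact of ℍ; degenerate parallelograms as α → ∂ℍ ∪ ∞) and CONTINUITY of α ↦ η(φ_α R′); a gap in either leaves the limit modulus on the real axis.
sources: LehtoVirtanen1973, Ahlfors1973CI, Beffara2008Universal, BollobasRiordan2010, tree:Literature.Probability.RandomPlanarGeometry.MarkedDomain.exists_isUniformizing_holds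
[crux] CLOSEDNESS (card C2, corrected per the novelty audit): assuming the uniform box-crossing
property along the segment and UniformMarginality, G is closed in [0,1]: if t_n → t with moduli α_n
then (α_n) is precompact in the open upper half-plane (uniform RSW forbids degenerate parallelogram
moduli), the crossing limits of M_t exist (marginality), and they equal F(η(φ_α R')) for a limit
modulus α (continuity of conformal moduli under near-identity linear maps). [deps:
UniformMarginality, UniformBoxCrossing] [difficulty: L] -/
@[route_item "route-CriticalPhenomena-CardySelfDualSegment", crux]
def SegmentClosed : Prop :=
  let prm : unitInterval → Literature.Probability.LatticeModels.Site 2 × Fin 2 → unitInterval := fun t i => if i.2 = 0 then Literature.Probability.Percolation.half else Literature.Probability.Percolation.half * t; let cfg : Set (Literature.Probability.LatticeModels.Site 2 × Fin 2) → Literature.Probability.Percolation.BondConfig (Literature.Probability.LatticeModels.Site 2) := fun S => {e | ∃ v : Literature.Probability.LatticeModels.Site 2, (e = s(v, v + ![1, 0]) ∧ (v, (0 : Fin 2)) ∈ S) ∨ (e = s(v, v + ![0, 1]) ∧ ((v, (0 : Fin 2)) ∈ S ↔ (v, (1 : Fin 2)) ∉ S))}; let P : unitInterval → Literature.Probability.RandomPlanarGeometry.ConformalRectangle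 → ℝ → ℝ := fun t R δ => (Literature.Probability.LatticeModels.prodBernoulli (prm t)).real {S | cfg S ∈ Literature.Probability.Percolation.embDomainCrossing Literature.Probability.LatticeModels.squareLatticeEmbedding.z R.carrier δ (R.arc 0) (R.arc 2)}; let CardyMod : unitInterval → ℂ → Prop := fun t α => ∀ (R R' : Literature.Probability.RandomPlanarGeometry.ConformalRectangle) (φ : Literature.Probability.RandomPlanarGeometry.ConformalEquiv UpperHalfPlane.upperHalfPlaneSet R.carrier) (x : Fin 4 → ℝ), R.carrier = Literature.Barriers.CriticalPhenomena.moduliShear α '' R'.carrier → (∀ i, R.pt i = Literature.Barriers.CriticalPhenomena.moduliShear α (R'.pt i)) → R.IsUniformizing φ x → Filter.Tendsto (P t R') (nhdsWithin 0 (Set.Ioi 0)) (nhds (Literature.Probability.RandomPlanarGeometry.cardyFunction (Literature.Probability.RandomPlanarGeometry.crossRatio x))); let G : Set unitInterval := {t | ∃ α : ℂ, 0 < α.im ∧ CardyMod t α}; (∀ ρ : ℝ, 0 < ρ → ∃ c > 0, ∃ n₀ : ℕ, ∀ t : unitInterval, Literature.Probability.LatticeModels.BoxCrossingBounds ((Literature.Probability.LatticeModels.prodBernoulli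 (prm t)).map cfg) Literature.Probability.LatticeModels.squareLatticeEmbedding.z ρ c n₀) → (∀ (t₀ : unitInterval) (R : Literature.Probability.RandomPlanarGeometry.ConformalRectangle) (ε : ℝ), 0 < ε → ∃ η > 0, ∀ t : unitInterval, dist t t₀ < η → ∀ δ : ℝ, 0 < δ → |P t R δ - P t₀ R δ| < ε) → IsClosed G

-- `SegmentClosed` holds: proved by `Summit.CriticalPhenomena.CardyFormulaZ2.Theorems.segmentClosed_proof` (its module imports this route file, so no `_holds` link can be stated here).

/-- item stmt-CriticalPhenomena-4968 · crux · rank 8 · closed · proved by Summit.CriticalPhenomena.CardyFormulaZ2.Theorems.crudeToCanonical_proof (prover) · by planner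
why it might fail: Crude event (2δ endpoint slack, all vertices in Ω, edges may leave Ω̄) and G02 event (largest component Ω_δ, distance-comparison arcs) differ near ∂Ω and the 4 marked points; equal limits need boundary arm/RSW control at ARBITRARY Jordan boundaries + a BR2006 Ch.7 sandwich, in print only for site-𝕋.
sources: BollobasRiordan2006, CamiaNewman2006, arXiv:1204.0505, tree:Literature.Probability.RandomPlanarGeometry.JordanDomain.exists_forall_mem_meshDomain_and_reachable, tree:Literature.Probability.Percolation.discreteCrossingProb_clusterPt_mem_Ioo_holds, stmt-CriticalPhenomena-0787
[crux] on ℤ², Cardy for the crude embedded crossing event (embDomainCrossing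
squareLatticeEmbedding.z: open path with all vertices in Ω, endpoints within 2δ of the arcs) in
EVERY conformal rectangle implies Cardy for G02's bondDomainCrossingProb (largest component Ω_δ,
discrete arcs by distance comparison) in every conformal rectangle. Global (∀R → ∀R) form of
stmt-CriticalPhenomena-0787 (route CardyIsoradial, per-R); a proof of 0787 closes it. [deps:
RenewalGridHarmless] [difficulty: M] -/
@[route_item "route-CriticalPhenomena-CardySelfDualSegment", crux]
def CrudeToCanonical : Prop :=
  (∀ R : Literature.Probability.RandomPlanarGeometry.ConformalRectangle, R.HasCrossingLimit (fun δ ↦ (Literature.Probability.Percolation.bondPercolation (Literature.Probability.LatticeModels.zdGraph 2) Literature.Probability.Percolation.half).real (Literature.Probability.Percolation.embDomainCrossing Literature.Probability.LatticeModels.squareLatticeEmbedding.z R.carrier δ (R.arc 0) (R.arc 2))) Literature.Probability.RandomPlanarGeometry.cardyFunction) → ∀ R : Literature.Probability.RandomPlanarGeometry.ConformalRectangle, R.HasCrossingLimit (Literature.Probability.Percolation.bondDomainCrossingProb R) Literature.Probability.RandomPlanarGeometry.cardyFunction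

/-- `CrudeToCanonical` holds: proved by `Summit.CriticalPhenomena.CardyFormulaZ2.Theorems.crudeToCanonical_proof`. -/
theorem CrudeToCanonical_holds : CrudeToCanonical := _root_.Summit.CriticalPhenomena.CardyFormulaZ2.Theorems.crudeToCanonical_proof

/-- item stmt-CriticalPhenomena-5474 · crux · rank 9 · closed · proved by Summit.CriticalPhenomena.CardyFormulaZ2.Theorems.smirnovBasePoint_proof (prover) · by planner
why it might fail: Law dictionary PROVED (cornerPercolation_zero: M_0 = triSite ½ pushed by upTriangleConfig); left: event transport (M_0 paths ↔ triGraph site paths up to closed leaf vertices, 2δ slack sheared by φ_ζ) and crude-event Cardy on 𝕋 in sheared rectangles φ_ζR′ — a crude↔G02 sandwich beyond Smirnov's thm.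
sources: Smirnov2001, BollobasRiordan2006, CamiaNewman2006, ChayesLei2006, tree:Literature.Probability.Percolation.cornerPercolation_zero, tree:Literature.Probability.Percolation.hasCrossingLimit_triDomainCrossingProb_holds
[support] BASE POINT 0 ∈ G with α_0 = e^(iπ/3) (card C4 dictionary, 𝕋 side): CardyMod 0 triZeta —
the square-frame M_0 (corner cells opened together = site percolation on the triangular lattice of
up-triangles, `triGraph` adjacency) crossing of R' converges to F(η(φ_ζ R')); this is Smirnov's
theorem `hasCrossingLimit_triDomainCrossingProb_holds` (proved in tree) pushed through `triEmbed =
φ_ζ ∘ toComplex`, plus boundary bookkeeping between the crude event `embDomainCrossing` (2δ slack,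
distorted by φ_ζ) and G02's `triCrossing` (largest component, discrete arcs) — boundary RSW on 𝕋,
all in tree (TriApproxDomain, TriCollarSandwich). [difficulty: M] -/
@[route_item "route-CriticalPhenomena-CardySelfDualSegment", crux]
def SmirnovBasePoint : Prop :=
  let prm : unitInterval → Literature.Probability.LatticeModels.Site 2 × Fin 2 → unitInterval := fun t i => if i.2 = 0 then Literature.Probability.Percolation.half else Literature.Probability.Percolation.half * t; let cfg : Set (Literature.Probability.LatticeModels.Site 2 × Fin 2) → Literature.Probability.Percolation.BondConfig (Literature.Probability.LatticeModels.Site 2) := fun S => {e | ∃ v : Literature.Probability.LatticeModels.Site 2, (e = s(v, v + ![1, 0]) ∧ (v, (0 : Fin 2)) ∈ S) ∨ (e = s(v, v + ![0, 1]) ∧ ((v, (0 : Fin 2)) ∈ S ↔ (v, (1 : Fin 2)) ∉ S))}; let P : unitInterval → Literature.Probability.RandomPlanarGeometry.ConformalRectangle → ℝ → ℝ := fun t R δ => (Literature.Probability.LatticeModels.prodBernoulli (prm t)).real {S | cfg S ∈ Literature.Probability.Percolation.embDomainCrossing Literature.Probability.LatticeModels.squareLatticeEmbedding.z R.carrier δ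 (R.arc 0) (R.arc 2)}; let CardyMod : unitInterval → ℂ → Prop := fun t α => ∀ (R R' : Literature.Probability.RandomPlanarGeometry.ConformalRectangle) (φ : Literature.Probability.RandomPlanarGeometry.ConformalEquiv UpperHalfPlane.upperHalfPlaneSet R.carrier) (x : Fin 4 → ℝ), R.carrier = Literature.Barriers.CriticalPhenomena.moduliShear α '' R'.carrier → (∀ i, R.pt i = Literature.Barriers.CriticalPhenomena.moduliShear α (R'.pt i)) → R.IsUniformizing φ x → Filter.Tendsto (P t R') (nhdsWithin 0 (Set.Ioi 0)) (nhds (Literature.Probability.RandomPlanarGeometry.cardyFunction (Literature.Probability.RandomPlanarGeometry.crossRatio x))); CardyMod 0 Literature.Probability.LatticeModels.triZeta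

-- `SmirnovBasePoint` holds: proved by `Summit.CriticalPhenomena.CardyFormulaZ2.Theorems.smirnovBasePoint_proof` (its module imports this route file, so no `_holds` link can be stated here).

/-- item stmt-CriticalPhenomena-5475 · crux · rank 9 · closed · proved by Summit.CriticalPhenomena.CardyFormulaZ2.Theorems.quarterTurnPinning_proof @ 68fa6316bebf (prover) · by planner
why it might fail: Formalisation risk only: M_1 = P_½ bond-ℤ² is PROVED (cornerPercolation_one); left: quarter-turn covariance of embDomainCrossing with transported marked points (rotation invariance of bond-ℤ²), uniformizing data on φ_α- /i-images; rigidity in tree (BeffaraShearDistortsModulus, similarityRigidity).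
sources: Beffara2008Universal, LanglandsPouliotSaintaubin1994, DKKMO2020Rotational, tree:Literature.Probability.Percolation.cornerPercolation_one, tree:Literature.Barriers.CriticalPhenomena.BeffaraShearDistortsModulus_holds, tree:Summit.CriticalPhenomena.CardyFormulaZ2.Theorems.similarityRigidity_proof
[support] ENDPOINT PINNING (card C3): if CardyMod 1 α holds for some α with Im α > 0 then bond
percolation on ℤ² at 1/2 satisfies Cardy's formula in the crude discretisation (`embDomainCrossing
squareLatticeEmbedding.z`). Proof: at t = 1 the corner law is the i.i.d. fair law, so P_1 = the
P_(1/2) crude crossing probability exactly; the quarter-turn r of ℤ² is an isometry of the square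
frame preserving measure and event, so CardyMod 1 α gives η(φ_α R') = η(φ_α r R') for all R', i.e.
the linear map φ_α r φ_α⁻¹ preserves all conformal moduli; by `BeffaraShearDistortsModulus_holds` (+
`BeffaraConjugateModulus_holds`) it is a similarity, and (φ_α r φ_α⁻¹)² = −1 forces it to be ±i·,
whence α = φ_α(i) = ±i·φ_α(1) = i; then take R = R'. [difficulty: M] -/
@[route_item "route-CriticalPhenomena-CardySelfDualSegment", crux]
def QuarterTurnPinning : Prop :=
  let prm : unitInterval → Literature.Probability.LatticeModels.Site 2 × Fin 2 → unitInterval := fun t i => if i.2 = 0 then Literature.Probability.Percolation.half else Literature.Probability.Percolation.half * t; let cfg : Set (Literature.Probability.LatticeModels.Site 2 × Fin 2) → Literature.Probability.Percolation.BondConfig (Literature.Probability.LatticeModels.Site 2) := fun S => {e | ∃ v : Literature.Probability.LatticeModels.Site 2, (e = s(v, v + ![1, 0]) ∧ (v, (0 : Fin 2)) ∈ S) ∨ (e = s(v, v + ![0, 1]) ∧ ((v, (0 : Fin 2)) ∈ S ↔ (v, (1 : Fin 2)) ∉ S))}; let P : unitInterval → Literature.Probability.RandomPlanarGeometry.ConformalRectangle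 → ℝ → ℝ := fun t R δ => (Literature.Probability.LatticeModels.prodBernoulli (prm t)).real {S | cfg S ∈ Literature.Probability.Percolation.embDomainCrossing Literature.Probability.LatticeModels.squareLatticeEmbedding.z R.carrier δ (R.arc 0) (R.arc 2)}; let CardyMod : unitInterval → ℂ → Prop := fun t α => ∀ (R R' : Literature.Probability.RandomPlanarGeometry.ConformalRectangle) (φ : Literature.Probability.RandomPlanarGeometry.ConformalEquiv UpperHalfPlane.upperHalfPlaneSet R.carrier) (x : Fin 4 → ℝ), R.carrier = Literature.Barriers.CriticalPhenomena.moduliShear α '' R'.carrier → (∀ i, R.pt i = Literature.Barriers.CriticalPhenomena.moduliShear α (R'.pt i)) → R.IsUniformizing φ x → Filter.Tendsto (P t R') (nhdsWithin 0 (Set.Ioi 0)) (nhds (Literature.Probability.RandomPlanarGeometry.cardyFunction (Literature.Probability.RandomPlanarGeometry.crossRatio x))); (∃ α : ℂ, 0 < α.im ∧ CardyMod 1 α) → ∀ R : Literature.Probability.RandomPlanarGeometry.ConformalRectangle, R.HasCrossingLimit (fun δ ↦ (Literature.Probability.Percolation.bondPercolation (Literature.Probability.LatticeModels.zdGraph 2)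 Literature.Probability.Percolation.half).real (Literature.Probability.Percolation.embDomainCrossing Literature.Probability.LatticeModels.squareLatticeEmbedding.z R.carrier δ (R.arc 0) (R.arc 2))) Literature.Probability.RandomPlanarGeometry.cardyFunction

-- `QuarterTurnPinning` holds: proved by `Summit.CriticalPhenomena.CardyFormulaZ2.Theorems.quarterTurnPinning_proof` @ 68fa6316bebf (its module imports this route file, so no `_holds` link can be stated here).

/-- item stmt-CriticalPhenomena-5476 · crux · rank 9 · open · by planner
why it might fail: may be FALSE, not just unproved: for 0<t<1 M_t has only translations + the diagonal swap; nothing excludes hard-way 2:1 crossings -> 0 along a subsequence of scales (BR 2010 Thm 6.3: only some large rectangles; KST 2023 Thm 1 needs all Z2 symmetries, Comment 5) or non-uniformity in t.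
sources: KohlerSchindlerTassion2023, Kesten1982, BollobasRiordan2010, Tassion2016, GrimmettManolescuAOP2013, Russo1978
[support] UNIFORM A-PRIORI THEORY (card C2): the box-crossing (RSW) property holds for the laws of
M_t drawn on √2ℤ², with constants c(ρ), n₀(ρ) uniform in t ∈ [0,1]: `BoxCrossingBounds` for every
aspect ratio. Inputs: P_t(square crossing) = ½ up to boundary terms for all t, δ (self-duality =
π-rotation + diagonal reflection), FKG (lattice condition iff t ≤ 1), translation invariance and ONE
reflection axis; NOT in print as such — KST 2023 need the full symmetry group of ℤ², BR 2010 §6 give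
only the large-rectangles property; route: Kesten's one-axis RSW (Kesten 1982 Ch. 6) after realising
M_t as periodic inhomogeneous site percolation on a planar gadget graph, or KST §6 symmetric
stochastic domination. [difficulty: L] -/
@[route_item "route-CriticalPhenomena-CardySelfDualSegment", crux]
def UniformBoxCrossing : Prop :=
  let prm : unitInterval → Literature.Probability.LatticeModels.Site 2 × Fin 2 → unitInterval := fun t i => if i.2 = 0 then Literature.Probability.Percolation.half else Literature.Probability.Percolation.half * t; let cfg : Set (Literature.Probability.LatticeModels.Site 2 × Fin 2) → Literature.Probability.Percolation.BondConfig (Literature.Probability.LatticeModels.Site 2) := fun S => {e | ∃ v : Literature.Probability.LatticeModels.Site 2, (e = s(v, v + ![1, 0]) ∧ (v, (0 : Fin 2)) ∈ S) ∨ (e = s(v, v + ![0, 1]) ∧ ((v, (0 : Fin 2)) ∈ S ↔ (v, (1 : Fin 2)) ∉ S))}; (∀ ρ : ℝ, 0 < ρ → ∃ c > 0, ∃ n₀ : ℕ, ∀ t : unitInterval, Literature.Probability.LatticeModels.BoxCrossingBounds ((Literature.Probability.LatticeModels.prodBernoulli (prm t)).map cfg) Literature.Probability.LatticeModels.squareLatticeEmbedding.z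 ρ c n₀)

/-- item stmt-CriticalPhenomena-14382 · support · rank 10 · closed · proved by Summit.CriticalPhenomena.CardyFormulaZ2.Theorems.continuitySweep_proof @ 748b204c5738 (prover) · by planner
[support] GLUE Crux… → Target (the continuity method on [0,1] read off; provable now, pure
topology): with G = {t ∈ [0,1] : ∃ α, Im α > 0 ∧ CardyMod t α}, SmirnovBasePoint gives 0 ∈ G (Im
triZeta = √3/2 > 0, `Literature.Probability.LatticeModels.triZeta_im` in TriangularLatticeProofs),
SegmentOpen fed by UniformMarginality gives G open, SegmentClosed fed by UniformBoxCrossing and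
UniformMarginality gives G closed; unitInterval is preconnected (`Subtype.preconnectedSpace
isPreconnected_Icc`), so `IsClopen.eq_univ` yields G = [0,1], which read pointwise is Target.
Checked sorry-free in the planner's Sketch.lean (12-line proof). Rank 10 (not 9) only so that the
gate renders this decl after SmirnovBasePoint, which it references by name (supports are ordered by
rank, then item id as a string). Supersedes the identically-meant stmt-CriticalPhenomena-14199
(TargetGlue, rank 9), which cannot be rendered at its position. [difficulty: provable-now] [sources:
Smirnov2001, Beffara2008Universal] -/
@[route_item "route-CriticalPhenomena-CardySelfDualSegment"]
def ContinuitySweep : Prop :=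
  SmirnovBasePoint → SegmentOpen → SegmentClosed → UniformMarginality → UniformBoxCrossing → Target

-- `ContinuitySweep` holds: proved by `Summit.CriticalPhenomena.CardyFormulaZ2.Theorems.continuitySweep_proof` @ 748b204c5738 (its module imports this route file, so no `_holds` link can be stated here).

-- earlier Assembly (stmt-CriticalPhenomena-5477, replaced 2026-08-16T04:54:31Z -> stmt-CriticalPhenomena-14650): retired by None — SegmentOpen → UniformMarginality → SegmentClosed → UniformBoxCrossing → SmirnovBasePoint → QuarterTurnPinning → DiscretisationBridge → CardyFormulaZ2
/-- item stmt-CriticalPhenomena-14650 · assembly · rank 1 · closed · proved by Summit.CriticalPhenomena.CardyFormulaZ2.Theorems.cardySelfDualSegment_assembly_proof @ 56d3d19375d4 (prover) · by planner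
sources: Smirnov2001, Beffara2008Universal
[assembly] SegmentOpen → UniformMarginality → SegmentClosed → UniformBoxCrossing → SmirnovBasePoint
→ QuarterTurnPinning → CrudeToCanonical → CardyFormulaZ2 — literally the statement of the deciding
theorem `closes` (crux-only since rev 13; the last hypothesis is the GLOBAL discretisation bridge
stmt-4968, shared with CardyIKTransport, replacing the per-R stmt-0787). Provable now: `closes`
itself is a proof (sweep on [0,1]: G clopen in the preconnected unitInterval, 0 ∈ G by Im ζ > 0). -/
@[route_item "route-CriticalPhenomena-CardySelfDualSegment"]
def Assembly : Prop :=
  SegmentOpen → UniformMarginality → SegmentClosed → UniformBoxCrossing → SmirnovBasePoint → QuarterTurnPinning → CrudeToCanonical → CardyFormulaZ2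

-- `Assembly` holds: proved by `Summit.CriticalPhenomena.CardyFormulaZ2.Theorems.cardySelfDualSegment_assembly_proof` @ 56d3d19375d4 (its module imports this route file, so no `_holds` link can be stated here).

/-! D-0027 §2.1 — DECIDING THEOREM (planner-authored via `route open/edit --closes-file`; by planner-rbadge-CriticalPhenomena-CardySelfDual-5e27c92a-g4-0 2026-08-16T04:46:45Z):
its hypotheses are this route's items and its conclusion the sub-problem Statement (glue_lint), and it elaborates with this file. -/

@[closes "route-CriticalPhenomena-CardySelfDualSegment"] theorem closes : SegmentOpen → UniformMarginality → SegmentClosed → UniformBoxCrossing →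
    SmirnovBasePoint → QuarterTurnPinning → CrudeToCanonical → _root_.CardyFormulaZ2 := by
  intro hO hM hC hX hB hQ hD R
  -- X → Statement: QuarterTurnPinning turns 1 ∈ G into crude Cardy on ℤ² for every conformal
  -- rectangle, and the global discretisation bridge CrudeToCanonical into CardyFormulaZ2.
  refine hD (hQ ?_) R
  -- cruxes → X, read at t = 1 (continuity method on [0,1]): G = {t | ∃ α, 0 < α.im ∧ CardyMod t α}
  -- is open (SegmentOpen fed by UniformMarginality), closed (SegmentClosed fed by
  -- UniformBoxCrossing and UniformMarginality) and contains 0 (SmirnovBasePoint, Im ζ > 0);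
  -- unitInterval is preconnected, so G = univ and in particular 1 ∈ G.
  have hGo := hO hM
  have hGc := hC hX hM
  have hclopen : IsClopen _ := ⟨hGc, hGo⟩
  have hz : 0 < Literature.Probability.LatticeModels.triZeta.im := by
    unfold Literature.Probability.LatticeModels.triZeta
    rw [Complex.exp_im]
    have hre : ((Real.pi : ℂ) * Complex.I / 3).re = 0 := by simp
    have him : ((Real.pi : ℂ) * Complex.I / 3).im = Real.pi / 3 := by simp
    rw [hre, him, Real.exp_zero, one_mul]
    exact Real.sin_pos_of_pos_of_lt_pi (by positivity) (by linarith [Real.pi_pos])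
  haveI : PreconnectedSpace unitInterval := Subtype.preconnectedSpace isPreconnected_Icc
  have huniv := hclopen.eq_univ ⟨0, Literature.Probability.LatticeModels.triZeta, hz, hB⟩
  exact (Set.eq_univ_iff_forall.mp huniv) 1

end Summit.CriticalPhenomena.CardyFormulaZ2.Theses.CardySelfDualSegment
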